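import Literature.AlgebraicGeometry.HodgeTheory.HardLefschetzHodgeRiemannHolds
import Literature.AlgebraicGeometry.HodgeTheory.HodgeIndexPrimitiveAlgebraic
import Literature.AlgebraicGeometry.HodgeTheory.HodgeIndexSurface
import Literature.AlgebraicGeometry.HodgeTheory.AlgebraicClassesHodgeTypeHolds
import Literature.Topology.FourManifolds.ComplexProjectiveSpaceCohomology
import HarnessLib

/-!
# The Hodge index theorem for primitive algebraic classes and for surfaces: discharges

Family `hodge`, layer `Literature/AlgebraicGeometry/HodgeTheory`. Theorems-only companion (no
definition, no named fact; D-0026) of the files `HodgeIndexPrimitiveAlgebraic` (named fact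
`hodgeIndex_primitiveAlgebraic n X`: Grothendieck's standard conjecture of Hodge type for the
hyperplane class of a smooth projective complex `n`-fold, sign-free — Murre §7.7 (HStC), Kleiman 1968
§3, Hartshorne App. A Thm. 5.2) and `HodgeIndexSurface` (named fact `hodgeIndex_surface X`: the Hodge
index theorem for a smooth projective surface, homological and sign-free form — Hartshorne V Thm. 1.9,
V Thm. 1.10, App. A Thm. 5.2). Both are now theorems of the tree:

* `HardLefschetzNFold.hasHodgeIndex_of_hodgeRiemann` — a hard Lefschetz datum whose class has the
  sign-free Hodge–Riemann anisotropy on rational primitive `(m,m)`-classes (the property recorded by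
  the named fact `hardLefschetz_hodgeRiemann d X`, C. Voisin, *Hodge Theory and Complex Algebraic
  Geometry I*, Thm. 6.32) has the Hodge index property on primitive ALGEBRAIC classes: an algebraic
  class `x ∈ Nᵖ H²ᵖ(X(ℂ); ℂ)` is of Hodge type `(p,p)` (Voisin I Prop. 11.20, the tree's theorem
  `isOfHodgeType_of_mem_algebraicClasses_of_isSmoothProjective`), and `x ∪ Lʳ x = Lʳ x ∪ x` in even
  degrees (graded commutativity of the Alexander–Whitney cup product, `cupProduct_gradedComm_holds`);
* `hodgeIndex_primitiveAlgebraic_holds` — **discharge of `hodgeIndex_primitiveAlgebraic n X`** for every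
  `(n, X)`, from the theorem `hardLefschetz_hodgeRiemann_holds` (file `HardLefschetzHodgeRiemannHolds`);
* `HardLefschetzNFold.cupProduct_hyperplaneClass_self_ne_zero` — on a smooth projective SURFACE the
  hyperplane class of a hard Lefschetz datum has `[H] ∪ [H] ≠ 0` ("`H² > 0`", Hartshorne V Thm. 1.10):
  `L² : H⁰(X(ℂ); ℂ) → H⁴(X(ℂ); ℂ)` is bijective (hard Lefschetz, Voisin I Thm. 6.25) and
  `L² 1 = [H] ∪ ([H] ∪ 1) = [H] ∪ [H]`, while `1 ≠ 0` in `H⁰` of the (non-empty, path-connected)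
  space `X(ℂ)` (`dim H⁰ = 1`, Hatcher §3.1 p. 199);
* `hodgeIndex_surface_holds` — **discharge of `hodgeIndex_surface X`** for every `X`: the witness is
  the hyperplane class `h = [H]` of the datum of `hodgeIndex_primitiveAlgebraic_holds 2 X` — rational,
  supported on a divisor, of type `(1,1)` (algebraic classes are Hodge classes), `h ∪ h ≠ 0` (previous
  item) — and the `∀ c` clause is `HardLefschetzNFold.HasHodgeIndex.surface` (file
  `HodgeIndexPrimitiveAlgebraic`).

Consequences already wired in the tree become unconditional, e.g. the non-degeneracy statements
`exists_cup_ne_zero_of_hodgeIndex` / `exists_rational_oneOne_cup_ne_zero` of `HodgeIndexSurface`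
(with `lefschetzOneOne_rational_holds`) and the per-surface Schoen descent partner
`exists_algebraic_partner_of_hodgeIndex_of_algebraic` of `WeilClassesDescendingTransfer`.

What is NOT here: the signs (the named facts are sign-free by design: no orientation
`H^{2n}(X(ℂ); ℂ) ≅ ℂ` is fixed on the summit carrier); the statement for the SPECIFIC class
`c₁(𝒪_X(1))` of a chosen embedding (the facts assert `∃ Λ` / `∃ h`, exactly what is discharged).

## References

* [MurreTorino1994] J. P. Murre, Algebraic cycles and algebraic aspects of cohomology and K-theory,
  LNM 1594 (1994), §7.7 (HStC).
* [Kleiman1968] S. L. Kleiman, Algebraic cycles and the Weil conjectures, in: Dix exposés sur la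
  cohomologie des schémas (1968), §3.
* [Hartshorne1977] R. Hartshorne, Algebraic Geometry (Springer 1977), V Thm. 1.9, V Thm. 1.10,
  App. A Thm. 5.2.
* [VoisinHodgeI2002] C. Voisin, Hodge Theory and Complex Algebraic Geometry I (CUP 2002), Thm. 6.25,
  Thm. 6.32, Prop. 11.20.
* [HatcherAT2002] A. Hatcher, Algebraic Topology (CUP 2002), §3.1 p. 199, §3.2 p. 211, Thm. 3.11.
-/

noncomputable section

open CategoryTheory AlgebraicGeometry Module
open Literature.AlgebraicTopology.SingularHomology Literature.Geometry.Kaehler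

namespace Literature.AlgebraicGeometry.HodgeTheory

section HodgeTheory

variable {n : ℕ} {X : Motives.SchemeOver ℂ}

/-! ### From Hodge–Riemann anisotropy to the Hodge index property on primitive algebraic classes -/

/-- **Hodge–Riemann anisotropy on rational primitive `(m,m)`-classes implies the Hodge index property on
primitive algebraic classes** (Murre §7.7: "in characteristic zero (HStC) is true by Hodge theory"):
for `Λ : HardLefschetzNFold n X` on a smooth projective `n`-fold whose class satisfies, for
`2m + s = n` and `y ∈ H^{2m}(X(ℂ); ℂ)` rational of type `(m,m)` with `L^{s+1} y = 0`, `y ≠ 0`, the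
anisotropy `Lˢ y ∪ y ≠ 0` (the clause of `hardLefschetz_hodgeRiemann n X`, Voisin I Thm. 6.32 sign-free),
every rational ALGEBRAIC non-zero primitive `x ∈ Nᵖ H²ᵖ` has `x ∪ Lʳ x ≠ 0` (`2p + r = n`): `x` is of type
`(p,p)` by Voisin I Prop. 11.20 (`isOfHodgeType_of_mem_algebraicClasses_of_isSmoothProjective`), and
`x ∪ Lʳ x = Lʳ x ∪ x` (graded commutativity in even degrees, Hatcher Thm. 3.11).
[cite: MurreTorino1994, §7.7 (HStC)] [cite: VoisinHodgeI2002, Thm. 6.32 and Prop. 11.20]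
[cite: HatcherAT2002, §3.2 Thm. 3.11] -/
theorem HardLefschetzNFold.hasHodgeIndex_of_hodgeRiemann (hX : Motives.IsSmoothProjective n X)
    (Λ : HardLefschetzNFold n X)
    (hHR : ∀ (m s : ℕ) (_ : 2 * m + s = n) (y : complexBetti X (2 * m)), IsRationalClass y →
      IsOfHodgeType n X (2 * m) m m y →
      Λ.L (s + 1) (2 * m) (2 * m + 2 * (s + 1)) rfl y = 0 → y ≠ 0 →
      cupProduct (show 2 * m + 2 * s + 2 * m = 2 * n by omega)
        (Λ.L s (2 * m) (2 * m + 2 * s) rfl y) y ≠ 0) :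
    Λ.HasHodgeIndex := by
  intro p r hpr x hxQ hxN hx0 hprim
  have hxT : IsOfHodgeType n X (2 * p) p p x :=
    isOfHodgeType_of_mem_algebraicClasses_of_isSmoothProjective hX p hxN
  have key := hHR p r hpr x hxQ hxT hprim hx0
  intro h0
  apply key
  rw [cupProduct_gradedComm_holds ℂ _ (show 2 * p + 2 * r + 2 * p = 2 * n by omega)
    (show 2 * p + (2 * p + 2 * r) = 2 * n by omega) (Λ.L r (2 * p) (2 * p + 2 * r) rfl x) x, h0,
    smul_zero]

/-- **`hodgeIndex_primitiveAlgebraic n X` HOLDS** (Grothendieck's standard conjecture of Hodge type for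
smooth projective complex varieties, sign-free, on primitive algebraic classes; Murre §7.7 (HStC),
Kleiman 1968 §3, Hartshorne App. A Thm. 5.2): the datum `Λ` of the theorem
`hardLefschetz_hodgeRiemann_holds` (hyperplane-type class of a projective embedding; hard Lefschetz,
Voisin I Thm. 6.25; Hodge–Riemann, Thm. 6.32) has the Hodge index property by
`HardLefschetzNFold.hasHodgeIndex_of_hodgeRiemann`. Relies on nothing unproved.
[cite: MurreTorino1994, §7.7 (HStC)] [cite: Kleiman1968, §3] [cite: Hartshorne1977, App. A Thm. 5.2]
[cite: VoisinHodgeI2002, Thm. 6.25 and Thm. 6.32] -/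
theorem hodgeIndex_primitiveAlgebraic_holds : hodgeIndex_primitiveAlgebraic n X := fun hX ↦ by
  obtain ⟨Λ, hHR⟩ := hardLefschetz_hodgeRiemann_holds (d := n) (X := X) hX
  exact ⟨Λ, Λ.hasHodgeIndex_of_hodgeRiemann hX hHR⟩

/-! ### The surface case -/

/-- **`1 ≠ 0` in `H⁰(X(ℂ); ℂ)`** for `X` smooth projective: `X(ℂ)` is path connected (connected, SGA1
XII Prop. 2.4, and a topological manifold), so `H⁰(X(ℂ); ℂ) = ℂ · 1` is a line (Hatcher §3.1 p. 199);
were `1 = 0` the line would be `0`. [cite: HatcherAT2002, §3.1 p. 199] -/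
theorem singularCohomology_one_complexPoints_ne_zero (hX : Motives.IsSmoothProjective n X) :
    singularCohomology.one ℂ (Motives.ComplexPoints X) ≠ 0 := by
  haveI : PathConnectedSpace (Motives.ComplexPoints X) :=
    pathConnectedSpace_complexPoints_of_isSmoothProjective hX
  intro h1
  have hsub : Subsingleton (singularCohomology ℂ ℂ (Motives.ComplexPoints X) 0) := by
    refine ⟨fun a b ↦ ?_⟩
    obtain ⟨s, rfl⟩ :=
      Literature.Topology.FourManifolds.ComplexProjectiveSpace.exists_eq_smul_one (K := ℂ) a
    obtain ⟨t, rfl⟩ :=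
      Literature.Topology.FourManifolds.ComplexProjectiveSpace.exists_eq_smul_one (K := ℂ) b
    rw [h1, smul_zero, smul_zero]
  have hfin : Module.finrank ℂ (singularCohomology ℂ ℂ (Motives.ComplexPoints X) 0) = 1 :=
    Literature.Topology.FourManifolds.ComplexProjectiveSpace.finrank_singularCohomology_zero
  rw [Module.finrank_zero_of_subsingleton] at hfin
  exact zero_ne_one hfin

/-- **`[H] ∪ [H] ≠ 0` on a surface** ("`H² > 0`", Hartshorne V Thm. 1.10 / Ex. V.1.1; here only the
non-vanishing): for a hard Lefschetz datum `Λ` on a smooth projective surface, `L² : H⁰(X(ℂ); ℂ) →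
H⁴(X(ℂ); ℂ)` is bijective (Voisin I Thm. 6.25 at `k = 0`), `L² 1 = [H] ∪ ([H] ∪ 1) = [H] ∪ [H]`
(`a ∪ 1 = a`, Hatcher §3.2 p. 211), and `1 ≠ 0` in `H⁰(X(ℂ); ℂ)`.
[cite: Hartshorne1977, V Thm. 1.10] [cite: VoisinHodgeI2002, Thm. 6.25] [cite: HatcherAT2002, §3.2 p. 211] -/
theorem HardLefschetzNFold.cupProduct_hyperplaneClass_self_ne_zero (hX : Motives.IsSmoothProjective 2 X)
    (Λ : HardLefschetzNFold 2 X) :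
    cupProduct two_add_two Λ.hyperplaneClass Λ.hyperplaneClass ≠ 0 := by
  intro hhh
  have hbij := Λ.bijective_L (j := 2) (k := 0) (by omega) 4 (by omega)
  -- `L² 1 = [H] ∪ ([H] ∪ 1) = [H] ∪ [H] = 0`
  have hL2 : Λ.L 2 0 4 (by omega) (singularCohomology.one ℂ (Motives.ComplexPoints X)) = 0 := by
    rw [HardLefschetzNFold.L, lefschetzPowTo_succ_apply Λ.hyperplaneClass 1 0 2 4 (by omega) (by omega)
      two_add_two, lefschetzPowTo_succ_apply Λ.hyperplaneClass 0 0 0 2 (by omega) (by omega) rfl,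
      lefschetzPowTo_zero_apply, lefschetzOperator_apply, lefschetzOperator_apply, cupProduct_one]
    exact hhh
  have h10 : singularCohomology.one ℂ (Motives.ComplexPoints X) = 0 :=
    hbij.1 (by rw [hL2, map_zero])
  exact singularCohomology_one_complexPoints_ne_zero hX h10

/-- **`hodgeIndex_surface X` HOLDS** (the Hodge index theorem for a smooth projective complex surface,
homological sign-free form: Hartshorne V Thm. 1.9 "`D ≢ 0`, `D.H = 0` ⟹ `D² < 0`" with V Thm. 1.10
`H² > 0` and App. A Thm. 5.2; Voisin I Thm. 6.32). Witness: the hyperplane class `h = [H]` of the datum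
`Λ` of `hodgeIndex_primitiveAlgebraic_holds 2 X` — rational (`Λ.isRationalClass_hyperplaneClass`),
supported on a divisor (`Λ.hyperplaneClass_mem`), hence of type `(1,1)` (Voisin I Prop. 11.20,
`isOfHodgeType_of_mem_algebraicClasses_of_isSmoothProjective`), with `h ∪ h ≠ 0`
(`HardLefschetzNFold.cupProduct_hyperplaneClass_self_ne_zero`); the clause on rational divisor classes
`c` with `c ∪ h = 0`, `c ≠ 0` is `HardLefschetzNFold.HasHodgeIndex.surface`. Relies on nothing unproved.
[cite: Hartshorne1977, V Thm. 1.9, V Thm. 1.10 and App. A Thm. 5.2] [cite: VoisinHodgeI2002, Thm. 6.32 and Prop. 11.20] -/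
theorem hodgeIndex_surface_holds : hodgeIndex_surface X := fun hX ↦ by
  obtain ⟨Λ, hΛ⟩ := hodgeIndex_primitiveAlgebraic_holds (n := 2) (X := X) hX
  refine ⟨Λ.hyperplaneClass, Λ.isRationalClass_hyperplaneClass, ?_, Λ.hyperplaneClass_mem,
    Λ.cupProduct_hyperplaneClass_self_ne_zero hX, fun c hcQ hcN hch hc0 ↦
      hΛ.surface c hcQ hcN hch hc0⟩
  exact isOfHodgeType_of_mem_algebraicClasses_of_isSmoothProjective hX 1 Λ.hyperplaneClass_mem

end HodgeTheory

end Literature.AlgebraicGeometry.HodgeTheory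

end
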